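import Mathlib.Topology.Algebra.Category.ProfiniteGrp.Completion
import Mathlib.GroupTheory.FreeGroup.IsFreeGroup
import Mathlib.GroupTheory.Index
import Literature.GroupTheory.CombinatorialGroupTheory.FreeGroupResiduallyFinite

/-!
# [EtTh] Lemma 2.17 (i) "Discrete Normalizers" — plumbing inside the profinite completion

Mochizuki, *The Étale Theta Function and its Frobenioid-theoretic Manifestations* [EtTh],
Publ. RIMS 45 (2009), §2, Lemma 2.17 (i), PRIMS text pp.58–59 (printed pp.284–285; locators
`p.N` = PDF pages of the PRIMS text; bib key `MochizukiEtTh2009`):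

> "Let `F` be a group that contains a normal subgroup of finite index `G ⊆ F` such that `G` is a
> free discrete group of finite rank; `H ⊆ F` a subgroup such that the group `H ⋂ G` is nonabelian.
> Write `F̂, Ĝ` for the profinite completions of `F, G` [so we have a natural inclusion `F ↪ F̂`].
> Then `N_{F̂}(H) = N_F(H)`."

This file is the PROOF-ONLY plumbing (no definitions, no named facts) used by the discharge file
`Discharge/Sec2DiscreteNormalizers.lean`, all over Mathlib's profinite completion
`F̂ = ProfiniteGrp.ProfiniteCompletion.completion (GrpCat.of F)` (the limit of the finite quotients
`F ⧸ N`, `N : FiniteIndexNormalSubgroup F`).  The map `η : F → F̂` enters every statement as an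
ARBITRARY homomorphism `η : F →* F̂` together with the hypothesis
`hη : ∀ g N, (η g).val N = QuotientGroup.mk g` ("`η` has the components of the canonical map");
Mathlib's `(ProfiniteGrp.ProfiniteCompletion.eta (GrpCat.of F)).hom` (and the cell's abbrev
`toCompletion F`) satisfy it by `rfl`, so every lemma applies to them verbatim:

* components `x.val N ∈ F ⧸ N` of elements of `F̂`, coherent families, the projections
  `F̂ → F ⧸ N` as homomorphisms, conjugacy read in finite quotients, closures
  (the printed "natural inclusion `F ↪ F̂`", p.58);
* finite-index subgroups `J ≤ F` seen from `F̂`: `η f` has all components in the image of `J`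
  only if `f ∈ J`; the coset decomposition "`a ∈ b · Ĵ` for some `b ∈ F`" (p.59, "since `J` is of
  finite index in `F`, it follows that there exists a `b ∈ F` such that `a ∈ b · Ĵ`");
* residual finiteness of virtually free groups, i.e. injectivity of `η` (the bracket
  "[so we have a natural inclusion `F ↪ F̂`]", p.58), from the tree's `freeGroup_residuallyFinite`;
* the TRANSFER between `cl(η(J)) ⊆ F̂` and the own completion `Ĵ` of a subgroup of finite index
  (p.59: "`F̂ ⊇ Ĵ`", "`F ⋂ Ĵ = J`"), in component form: an element of `F̂` with components in
  `φ(T)` (`φ : T ↪ F` of finite-index image) yields `γ ∈ T̂` satisfying the same conjugation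
  relations, and `γ = η(t₀)` forces the original element to be `η(φ t₀)`.

Honest framing: classical profinite group theory; nothing here concerns [IUTchIII] Cor. 3.12.
-/

namespace Literature.AnabelianGeometry.EtaleTheta.DiscreteNormalizers

open CategoryTheory ProfiniteGrp ProfiniteGrp.ProfiniteCompletion Topology

universe u

variable {F : Type u} [Group F]

/-! ### Components of elements of `F̂` (elementary plumbing) -/

/-- Elements of `F̂` are determined by their components. [cite: MochizukiEtTh2009, Lem 2.17(i) p.58] -/
theorem ext_val {x y : completion (GrpCat.of F)} (h : ∀ N : FiniteIndexNormalSubgroup F, x.val N = y.val N) : x = y :=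
  Subtype.ext (funext h)

/-- Every component of an element of `F̂` is the class of some element of `F`. [cite: MochizukiEtTh2009, Lem 2.17(i) p.58] -/
theorem exists_val_eq_mk (x : completion (GrpCat.of F)) (N : FiniteIndexNormalSubgroup F) :
    ∃ g : F, x.val N = (QuotientGroup.mk g : F ⧸ N.toSubgroup) := by
  obtain ⟨g, hg⟩ := QuotientGroup.mk_surjective (x.val N)
  exact ⟨g, hg.symm⟩

/-- Compatibility of components in coset form. [cite: MochizukiEtTh2009, Lem 2.17(i) p.58] -/
theorem val_eq_mk_of_le (x : completion (GrpCat.of F)) {N M : FiniteIndexNormalSubgroup F} (h : N ≤ M)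
    {g : F} (hg : x.val N = (QuotientGroup.mk g : F ⧸ N.toSubgroup)) :
    x.val M = (QuotientGroup.mk g : F ⧸ M.toSubgroup) := by
  have hx := x.property (homOfLE h)
  rw [← hx]
  change (diagram (GrpCat.of F)).map (homOfLE h) (x.val N) = _
  rw [hg]
  rfl

/-- An element of `F̂` equals `η g` iff all its components are the classes of `g`. [cite: MochizukiEtTh2009, Lem 2.17(i) p.58] -/
theorem eq_eta_iff (η : F →* completion (GrpCat.of F))
    (hη : ∀ (g : F) (N : FiniteIndexNormalSubgroup F),
      (η g).val N = (QuotientGroup.mk g : F ⧸ N.toSubgroup)) (x : completion (GrpCat.of F)) (g : F) :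
    x = η g ↔ ∀ N : FiniteIndexNormalSubgroup F, x.val N = (QuotientGroup.mk g : F ⧸ N.toSubgroup) := by
  constructor
  · rintro rfl N
    exact hη g N
  · intro h
    exact ext_val fun N => (h N).trans (hη g N).symm

/-- The `N`-th component as a group homomorphism `F̂ → F ⧸ N`. [cite: MochizukiEtTh2009, Lem 2.17(i) p.58] -/
theorem exists_proj (N : FiniteIndexNormalSubgroup F) :
    ∃ π : completion (GrpCat.of F) →* F ⧸ N.toSubgroup, ∀ x, π x = x.val N :=
  ⟨MonoidHom.mk' (fun x => (x.val N : F ⧸ N.toSubgroup)) fun _ _ => rfl, fun _ => rfl⟩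

/-- Coherent families of representatives define elements of `F̂`. [cite: MochizukiEtTh2009, Lem 2.17(i) p.58] -/
theorem exists_val_eq_of_coherent (g : FiniteIndexNormalSubgroup F → F)
    (hg : ∀ N M : FiniteIndexNormalSubgroup F, N ≤ M →
      (QuotientGroup.mk (g N) : F ⧸ M.toSubgroup) = QuotientGroup.mk (g M)) :
    ∃ x : completion (GrpCat.of F), ∀ N : FiniteIndexNormalSubgroup F,
      x.val N = (QuotientGroup.mk (g N) : F ⧸ N.toSubgroup) :=
  ⟨⟨fun N => QuotientGroup.mk (g N), fun N M π => by
      change (QuotientGroup.mk (g N) : F ⧸ M.toSubgroup) = QuotientGroup.mk (g M)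
      exact hg N M π.le⟩,
    fun _ => rfl⟩

/-- Conjugation in `F̂` read in a finite quotient. [cite: MochizukiEtTh2009, Lem 2.17(i) p.58] -/
theorem mk_conj_eq_of_conj_eq (η : F →* completion (GrpCat.of F))
    (hη : ∀ (g : F) (N : FiniteIndexNormalSubgroup F),
      (η g).val N = (QuotientGroup.mk g : F ⧸ N.toSubgroup))
    {u v : F} (γ : completion (GrpCat.of F)) (h : γ * η u * γ⁻¹ = η v)
    (N : FiniteIndexNormalSubgroup F) (c : F) (hc : γ.val N = (QuotientGroup.mk c : F ⧸ N.toSubgroup)) :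
    (QuotientGroup.mk (c * u * c⁻¹) : F ⧸ N.toSubgroup) = QuotientGroup.mk v := by
  obtain ⟨π, hπ⟩ := exists_proj N
  have hγ : π γ = QuotientGroup.mk c := by rw [hπ, hc]
  have := congrArg π h
  rw [map_mul, map_mul, map_inv, hγ, hπ, hπ, hη, hη] at this
  rwa [← QuotientGroup.mk_inv, ← QuotientGroup.mk_mul, ← QuotientGroup.mk_mul] at this

/-- Conjugacy in `F̂` descends to every finite quotient. [cite: MochizukiEtTh2009, Lem 2.17(i) p.58] -/
theorem isConj_mk_of_isConj_eta (η : F →* completion (GrpCat.of F))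
    (hη : ∀ (g : F) (N : FiniteIndexNormalSubgroup F),
      (η g).val N = (QuotientGroup.mk g : F ⧸ N.toSubgroup))
    {u v : F} (h : IsConj (η u) (η v)) (N : FiniteIndexNormalSubgroup F) :
    IsConj (QuotientGroup.mk u : F ⧸ N.toSubgroup) (QuotientGroup.mk v) := by
  obtain ⟨π, hπ⟩ := exists_proj N
  have := π.map_isConj h
  rwa [hπ, hπ, hη, hη] at this

/-- The projections `F̂ → F ⧸ N` are continuous (discrete topology on the quotient). [cite: MochizukiEtTh2009, Lem 2.17(i) p.58] -/
theorem continuous_val (N : FiniteIndexNormalSubgroup F) :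
    Continuous fun x : completion (GrpCat.of F) => x.val N :=
  (continuous_apply N).comp continuous_subtype_val

/-- Points of the closure of `η(S)` have every component in the image of `S`. [cite: MochizukiEtTh2009, Lem 2.17(i) p.58] -/
theorem val_mem_image_of_mem_closure (η : F →* completion (GrpCat.of F))
    (hη : ∀ (g : F) (N : FiniteIndexNormalSubgroup F),
      (η g).val N = (QuotientGroup.mk g : F ⧸ N.toSubgroup))
    {S : Set F} {x : completion (GrpCat.of F)}
    (hx : x ∈ closure (η '' S)) (N : FiniteIndexNormalSubgroup F) :
    x.val N ∈ (QuotientGroup.mk : F → F ⧸ N.toSubgroup) '' S := by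
  haveI : DiscreteTopology ((diagram (GrpCat.of F)).obj N) := ⟨rfl⟩
  have hclosed : IsClosed ((fun y : completion (GrpCat.of F) => y.val N) ⁻¹'
      ((QuotientGroup.mk : F → F ⧸ N.toSubgroup) '' S)) :=
    (isClosed_discrete _).preimage (continuous_val N)
  have hsub : η '' S ⊆
      (fun y : completion (GrpCat.of F) => y.val N) ⁻¹' ((QuotientGroup.mk : F → F ⧸ N.toSubgroup) '' S) := by
    rintro _ ⟨s, hs, rfl⟩
    exact ⟨s, hs, (hη s N).symm⟩
  exact hclosed.closure_subset_iff.mpr hsub hx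

/-- Points of the topological closure of `⟨η t⟩` have, at every level, a component that is a power
of the class of `t`. [cite: MochizukiEtTh2009, Lem 2.17(i) p.58] -/
theorem exists_val_eq_mk_zpow_of_mem_closure_zpowers (η : F →* completion (GrpCat.of F))
    (hη : ∀ (g : F) (N : FiniteIndexNormalSubgroup F),
      (η g).val N = (QuotientGroup.mk g : F ⧸ N.toSubgroup))
    (t : F) {x : completion (GrpCat.of F)}
    (hx : x ∈ (Subgroup.zpowers (η t)).topologicalClosure) (N : FiniteIndexNormalSubgroup F) :
    ∃ k : ℤ, x.val N = (QuotientGroup.mk (t ^ k) : F ⧸ N.toSubgroup) := by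
  have hx' : x ∈ closure (η '' (Subgroup.zpowers t : Set F)) := by
    have h1 : (η '' (Subgroup.zpowers t : Set F)) =
        (Subgroup.zpowers (η t) : Set (completion (GrpCat.of F))) := by
      rw [← Subgroup.coe_map, MonoidHom.map_zpowers]
    rw [h1]
    exact hx
  obtain ⟨s, hs, hsx⟩ := val_mem_image_of_mem_closure η hη hx' N
  obtain ⟨k, rfl⟩ := Subgroup.mem_zpowers_iff.mp hs
  exact ⟨k, hsx.symm⟩

/-! ### Finite-index subgroups seen from `F̂` -/

/-- If, at the level `core(J)`, the class of `f` is the class of an element of the finite-index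
subgroup `J`, then `f ∈ J`. [cite: MochizukiEtTh2009, Lem 2.17(i) p.58] -/
theorem mem_of_mk_eq_mk_normalCore (J : Subgroup F) [J.FiniteIndex] {f j : F} (hj : j ∈ J)
    (h : (QuotientGroup.mk f : F ⧸ J.normalCore) = QuotientGroup.mk j) : f ∈ J := by
  rw [QuotientGroup.eq] at h
  have h1 : f⁻¹ * j ∈ J := J.normalCore_le h
  have h2 : f⁻¹ ∈ J := by simpa using J.mul_mem h1 (J.inv_mem hj)
  exact (Subgroup.inv_mem_iff J).mp h2

/-- `η f` has all components in the image of `J` only if `f ∈ J` (for `J` of finite index). [cite: MochizukiEtTh2009, Lem 2.17(i) p.58] -/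
theorem mem_of_forall_val_eta (η : F →* completion (GrpCat.of F))
    (hη : ∀ (g : F) (N : FiniteIndexNormalSubgroup F),
      (η g).val N = (QuotientGroup.mk g : F ⧸ N.toSubgroup))
    (J : Subgroup F) [J.FiniteIndex] {f : F}
    (h : ∀ N : FiniteIndexNormalSubgroup F, ∃ j ∈ J,
      (η f).val N = (QuotientGroup.mk j : F ⧸ N.toSubgroup)) : f ∈ J := by
  obtain ⟨j, hj, hfj⟩ := h (FiniteIndexNormalSubgroup.ofSubgroup J.normalCore)
  rw [hη] at hfj
  exact mem_of_mk_eq_mk_normalCore J hj hfj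

/-- **Coset decomposition** `F̂ = η(F) · cl(η(J))` for a finite-index subgroup `J ≤ F`, in component
form: every `a ∈ F̂` is `η(b) · a₀` with `b ∈ F` and all components of `a₀` in the image of `J`. [cite: MochizukiEtTh2009, Lem 2.17(i) p.58] -/
theorem exists_eta_mul_of_finiteIndex (η : F →* completion (GrpCat.of F))
    (hη : ∀ (g : F) (N : FiniteIndexNormalSubgroup F),
      (η g).val N = (QuotientGroup.mk g : F ⧸ N.toSubgroup))
    (J : Subgroup F) [J.FiniteIndex] (a : completion (GrpCat.of F)) :
    ∃ b : F, ∀ N : FiniteIndexNormalSubgroup F, ∃ j ∈ J,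
      ((η b)⁻¹ * a).val N = (QuotientGroup.mk j : F ⧸ N.toSubgroup) := by
  let N₀ : FiniteIndexNormalSubgroup F := FiniteIndexNormalSubgroup.ofSubgroup J.normalCore
  obtain ⟨b, hb⟩ := exists_val_eq_mk a N₀
  refine ⟨b, fun N => ?_⟩
  obtain ⟨c, hc⟩ := exists_val_eq_mk a (N ⊓ N₀)
  have hc₀ : a.val N₀ = (QuotientGroup.mk c : F ⧸ N₀.toSubgroup) := val_eq_mk_of_le a inf_le_right hc
  have hcN : a.val N = (QuotientGroup.mk c : F ⧸ N.toSubgroup) := val_eq_mk_of_le a inf_le_left hc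
  have hbc : b⁻¹ * c ∈ J := by
    rw [hb] at hc₀
    exact J.normalCore_le (QuotientGroup.eq.mp hc₀)
  refine ⟨b⁻¹ * c, hbc, ?_⟩
  obtain ⟨π, hπ⟩ := exists_proj N
  rw [← hπ, map_mul, map_inv, hπ, hπ, hη, hcN, ← QuotientGroup.mk_inv, ← QuotientGroup.mk_mul]

/-! ### Residual finiteness of virtually free groups (injectivity of `η`) -/

/-- Residual finiteness passes along group isomorphisms. [cite: MochizukiEtTh2009, Lem 2.17(i) p.58] -/
theorem residuallyFinite_of_mulEquiv {G H : Type*} [Group G] [Group H] (e : G ≃* H)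
    [Group.ResiduallyFinite G] : Group.ResiduallyFinite H := by
  rw [Group.residuallyFinite_iff_exists_finiteIndex]
  intro h hh
  have hg : e.symm h ≠ 1 := by simpa using hh
  obtain ⟨K, hK, hgK⟩ := (Group.residuallyFinite_iff_exists_finiteIndex.mp ‹_›) (e.symm h) hg
  have hsurj : Function.Surjective (e.symm.toMonoidHom : H →* G) := fun x => ⟨e x, by simp⟩
  refine ⟨K.comap e.symm.toMonoidHom, ?_, by simpa using hgK⟩
  rw [Subgroup.finiteIndex_iff] at hK ⊢
  rwa [K.index_comap_of_surjective hsurj]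

/-- A group with a residually finite subgroup of finite index is residually finite. [cite: MochizukiEtTh2009, Lem 2.17(i) p.58] -/
theorem residuallyFinite_of_finiteIndex (G : Subgroup F) [G.FiniteIndex]
    [Group.ResiduallyFinite G] : Group.ResiduallyFinite F := by
  rw [Group.residuallyFinite_iff_exists_finiteIndex]
  intro f hf
  by_cases hfG : f ∈ G
  · have hne : (⟨f, hfG⟩ : G) ≠ 1 := by
      intro h
      exact hf (congrArg Subtype.val h)
    obtain ⟨K, hK, hfK⟩ :=
      (Group.residuallyFinite_iff_exists_finiteIndex.mp ‹_›) (⟨f, hfG⟩ : G) hne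
    refine ⟨K.map G.subtype, ?_, ?_⟩
    · rw [Subgroup.finiteIndex_iff, Subgroup.index_map_subtype]
      exact mul_ne_zero hK.index_ne_zero Subgroup.FiniteIndex.index_ne_zero
    · rintro ⟨y, hy, hyf⟩
      apply hfK
      have : y = ⟨f, hfG⟩ := Subtype.ext hyf
      rwa [← this]
  · exact ⟨G, inferInstance, hfG⟩

/-- Free groups (in the sense of `IsFreeGroup`) are residually finite
(tree: `freeGroup_residuallyFinite`). [cite: MochizukiEtTh2009, Lem 2.17(i) p.58] -/
theorem residuallyFinite_of_isFreeGroup (G : Type*) [Group G] [IsFreeGroup G] :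
    Group.ResiduallyFinite G :=
  haveI := Literature.GroupTheory.CombinatorialGroupTheory.freeGroup_residuallyFinite
    (IsFreeGroup.Generators G)
  residuallyFinite_of_mulEquiv (IsFreeGroup.toFreeGroup G).symm

/-- `η : F → F̂` is injective when `F` is residually finite ("[so we have a natural inclusion
`F ↪ F̂`]", p.58). [cite: MochizukiEtTh2009, Lem 2.17(i) p.58] -/
theorem eta_injective_of_residuallyFinite (η : F →* completion (GrpCat.of F))
    (hη : ∀ (g : F) (N : FiniteIndexNormalSubgroup F),
      (η g).val N = (QuotientGroup.mk g : F ⧸ N.toSubgroup))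
    [Group.ResiduallyFinite F] : Function.Injective η := by
  intro a b h
  have hab : ∀ N : FiniteIndexNormalSubgroup F, a⁻¹ * b ∈ N := by
    intro N
    have h1 : (η a).val N = (η b).val N := by rw [h]
    rw [hη, hη] at h1
    exact QuotientGroup.eq.mp h1
  have := Group.eq_one_iff_forall_finiteIndexNormalSubroup (a⁻¹ * b) hab
  exact (inv_mul_eq_one.mp this)

/-- `η : F → F̂` is injective when `F` has a free subgroup of finite index (the situation of
Lemma 2.17 (i)). [cite: MochizukiEtTh2009, Lem 2.17(i) p.58] -/
theorem eta_injective_of_virtuallyFree (η : F →* completion (GrpCat.of F))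
    (hη : ∀ (g : F) (N : FiniteIndexNormalSubgroup F),
      (η g).val N = (QuotientGroup.mk g : F ⧸ N.toSubgroup))
    (G : Subgroup F) [G.FiniteIndex] [IsFreeGroup G] : Function.Injective η := by
  haveI := residuallyFinite_of_isFreeGroup G
  haveI : Group.ResiduallyFinite F := residuallyFinite_of_finiteIndex G
  exact eta_injective_of_residuallyFinite η hη

/-! ### Transfer to the completion of a finite-index subgroup -/

/-- **Transfer.** Let `φ : T → F` be injective with image of finite index, and let `a₀ ∈ F̂` have all
its components in the image of `φ(T)`.  Then there is `γ ∈ T̂` which (1) satisfies every conjugation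
relation `γ · η(z) · γ⁻¹ = η(w)` whose image `a₀ · η(φ z) · a₀⁻¹ = η(φ w)` holds in `F̂`, and (2) is
of the form `η(t₀)` only if `a₀ = η(φ t₀)`.  (Component-wise construction of the inverse of
`T̂ ⥲ cl(η(φ T)) ⊆ F̂` on `a₀`.) [cite: MochizukiEtTh2009, Lem 2.17(i) p.58] -/
theorem exists_transfer (η : F →* completion (GrpCat.of F))
    (hη : ∀ (g : F) (N : FiniteIndexNormalSubgroup F),
      (η g).val N = (QuotientGroup.mk g : F ⧸ N.toSubgroup))
    {T : Type u} [Group T] (ηT : T →* completion (GrpCat.of T))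
    (hηT : ∀ (g : T) (N : FiniteIndexNormalSubgroup T),
      (ηT g).val N = (QuotientGroup.mk g : T ⧸ N.toSubgroup))
    (φ : T →* F) (hφ : Function.Injective φ)
    [φ.range.FiniteIndex] (a₀ : completion (GrpCat.of F))
    (h₀ : ∀ N : FiniteIndexNormalSubgroup F, ∃ t : T,
      a₀.val N = (QuotientGroup.mk (φ t) : F ⧸ N.toSubgroup)) :
    ∃ γ : completion (GrpCat.of T),
      (∀ z w : T, a₀ * η (φ z) * a₀⁻¹ = η (φ w) → γ * ηT z * γ⁻¹ = ηT w) ∧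
      (∀ t₀ : T, γ = ηT t₀ → a₀ = η (φ t₀)) := by
  classical
  -- `φ(N')` has finite index in `F` for every finite-index `N' ≤ T`
  have hfi : ∀ N' : FiniteIndexNormalSubgroup T, (N'.toSubgroup.map φ).FiniteIndex := by
    intro N'
    rw [Subgroup.finiteIndex_iff, N'.toSubgroup.index_map_of_injective hφ]
    exact mul_ne_zero Subgroup.FiniteIndex.index_ne_zero Subgroup.FiniteIndex.index_ne_zero
  -- the level `M(N') = core_F(φ(N'))` of `F` attached to a level `N'` of `T`
  let M : FiniteIndexNormalSubgroup T → FiniteIndexNormalSubgroup F := fun N' =>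
    haveI := hfi N'
    FiniteIndexNormalSubgroup.ofSubgroup (N'.toSubgroup.map φ).normalCore
  have hMle : ∀ (N' : FiniteIndexNormalSubgroup T) (x : F), x ∈ M N' → x ∈ N'.toSubgroup.map φ :=
    fun N' x hx => Subgroup.normalCore_le (H := N'.toSubgroup.map φ) hx
  have hback : ∀ (N' : FiniteIndexNormalSubgroup T) (t : T),
      φ t ∈ N'.toSubgroup.map φ → t ∈ N' := by
    intro N' t ht
    obtain ⟨s, hs, hst⟩ := ht
    rw [← hφ hst]
    exact hs
  -- representatives of the components of `a₀` at the levels `M(N')`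
  choose g hg using fun N' => h₀ (M N')
  -- coherence of the family `g`
  have hcoh : ∀ N' N'' : FiniteIndexNormalSubgroup T, N' ≤ N'' →
      (QuotientGroup.mk (g N') : T ⧸ N''.toSubgroup) = QuotientGroup.mk (g N'') := by
    intro N' N'' hle
    obtain ⟨c, hc⟩ := exists_val_eq_mk a₀ (M N' ⊓ M N'')
    have h1 : a₀.val (M N') = (QuotientGroup.mk c : F ⧸ (M N').toSubgroup) :=
      val_eq_mk_of_le a₀ inf_le_left hc
    have h2 : a₀.val (M N'') = (QuotientGroup.mk c : F ⧸ (M N'').toSubgroup) :=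
      val_eq_mk_of_le a₀ inf_le_right hc
    rw [hg N'] at h1
    rw [hg N''] at h2
    have e1 : (φ (g N'))⁻¹ * c ∈ N''.toSubgroup.map φ :=
      Subgroup.map_mono (show N'.toSubgroup ≤ N''.toSubgroup from hle)
        (hMle N' _ (QuotientGroup.eq.mp h1))
    have e2 : (φ (g N''))⁻¹ * c ∈ N''.toSubgroup.map φ := hMle N'' _ (QuotientGroup.eq.mp h2)
    have e3 : φ ((g N')⁻¹ * g N'') ∈ N''.toSubgroup.map φ := by
      have := Subgroup.mul_mem _ e1 (Subgroup.inv_mem _ e2)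
      simpa [mul_assoc] using this
    exact QuotientGroup.eq.mpr (hback N'' _ e3)
  obtain ⟨γ, hγ⟩ := exists_val_eq_of_coherent g hcoh
  refine ⟨γ, ?_, ?_⟩
  · intro z w hzw
    apply ext_val
    intro N'
    have key := mk_conj_eq_of_conj_eq η hη a₀ hzw (M N') (φ (g N')) (hg N')
    have e1 : (φ (g N' * z * (g N')⁻¹))⁻¹ * φ w ∈ N'.toSubgroup.map φ := by
      apply hMle N'
      apply QuotientGroup.eq.mp
      simpa only [map_mul, map_inv] using key
    have e2 : (g N' * z * (g N')⁻¹)⁻¹ * w ∈ N' := by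
      apply hback N'
      simpa only [map_mul, map_inv] using e1
    obtain ⟨π, hπ⟩ := exists_proj N'
    rw [← hπ, ← hπ, map_mul, map_mul, map_inv, hπ, hπ, hπ, hγ N', hηT, hηT,
      ← QuotientGroup.mk_inv, ← QuotientGroup.mk_mul, ← QuotientGroup.mk_mul]
    exact QuotientGroup.eq.mpr e2
  · intro t₀ ht₀
    rw [eq_eta_iff η hη]
    intro N
    let N' : FiniteIndexNormalSubgroup T := N.comap φ
    have hle : M N' ≤ N := by
      intro x hx
      exact Subgroup.map_comap_le φ N.toSubgroup (hMle N' x hx)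
    have h1 : a₀.val N = (QuotientGroup.mk (φ (g N')) : F ⧸ N.toSubgroup) :=
      val_eq_mk_of_le a₀ hle (hg N')
    have h2 : γ.val N' = (QuotientGroup.mk t₀ : T ⧸ N'.toSubgroup) := by rw [ht₀, hηT]
    rw [hγ N'] at h2
    have h3 : (g N')⁻¹ * t₀ ∈ N' := QuotientGroup.eq.mp h2
    rw [h1]
    apply QuotientGroup.eq.mpr
    have : φ ((g N')⁻¹ * t₀) ∈ N.toSubgroup := h3
    simpa only [map_mul, map_inv] using this

end Literature.AnabelianGeometry.EtaleTheta.DiscreteNormalizers
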